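import Summits.ResolutionOfSingularities.ResolutionOfSingularities.Theorems.FrobeniusLadderFInjectiveMacaulayficationCIConeFiModelSmooth
import Summits.ResolutionOfSingularities.ResolutionOfSingularities.Theorems.FrobeniusLadderFInjectiveMacaulayficationT4PlusPrime
import Summits.ResolutionOfSingularities.ResolutionOfSingularities.Theorems.FrobeniusLadderFInjectiveMacaulayficationT4PlusOffStratum
import HarnessLib

/-!
# K-T4 assembly for `T⁽⁴⁾⁺` (crux `FInjectiveMacaulayfication`, K-T4 Lean half at the deciding specimen, road A piece (vi))

[OURS · L1 W4.5a] Support file for crux stmt-ResolutionOfSingularities-15315, chain w45a, seat res-L1-w45a-stub-4 (planner rulings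
R12.9 (b), R12.12 (b), R12.22 (D): «`T4PlusFiModel` GO on stub-4's binder»; the 6-variable twin of stub-6's `T11PlusFiModel`,
p513799). The cone-Fi model `CIConeFiModelSmooth.ciConeFiModelRel_of_smoothFaceCertificates` (stub-1, p507224) is specialised to
the deciding specimen `T⁽⁴⁾⁺ = V(Φ − y² − x³, z² + Φ³ + w⁷ + v⁸ + x¹²) ⊂ 𝔸⁶` in characteristic `7` (variables
`(x, y, z, w, v, Φ) = (X 0, …, X 5)`, stratum `J = {0, 5} = V(x, Φ) ∩ X`), with the three NON-DATA kernel hypotheses discharged by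
landed theorems: primality of `(F₀, F₁)` and non-vanishing of the variables (`T4PlusPrime.t4plus_prime_and_X_ne_zero`, stub-6,
p509017) and the crux clause at every closed point off the stratum (`T4PlusOffStratum.t4Plus_hoff_char7`, stub-4 — Jacobian minors
plus Fedder's criterion at the F-pure singular circle `x³ = 1`). What remains hypothetical is exactly THE CHART LIST of a
closed-centre weighted normal-crossings resolution datum (fan support `A`, vertices `m`, unimodular cones `V` with generators `a`,
strict transforms `gs`, `d`, and the smooth-face certificates `hcert` on the strata over `V(x, Φ)`), per R11.12 («kernel hypotheses
of p507224 minus the chart list»): `t4PlusFiModelRel_of_charts`. The `hcert` entries are what `CIThetaTransport.hcert_of_cellCertificate`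
produces from the landed CELL certificates `T4PlusCells*`. No definition is declared; AI-written, weaker than expert review; no
statement of [claim: Hironaka2017] is used. [folklore]
-/

-- single-problem summit: the doubled namespace component is forced
set_option linter.dupNamespace false

noncomputable section

namespace Summit.ResolutionOfSingularities.ResolutionOfSingularities.Theorems.FInjectiveMacaulayfication.T4PlusFiModel

open MvPolynomial AlgebraicGeometry

/-- **K-T4 assembly for `T⁽⁴⁾⁺` at `p = 7`, conditional on the chart list.** Given a closed-centre weighted normal-crossings chart
datum for `T⁽⁴⁾⁺ ⊂ 𝔸⁶` over the stratum `V(x, Φ)` (the binders `A … hcert`, shape of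
`CIConeFiModelSmooth.ciConeFiModelRel_of_smoothFaceCertificates` with `n = 6`, `r = 2`, `J = {0, 5}`), the affine model
`Spec k[x,y,z,w,v,Φ]/(Φ − y² − x³, z² + Φ³ + w⁷ + v⁸ + x¹²)` admits a proper birational `X' → X` all of whose stalks are domains
satisfying the crux clause (CM + F-injective in the inline form). [folklore] -/
theorem t4PlusFiModelRel_of_charts (k : Type) [Field k] [CharP k 7] (Fs : Fin 2 → MvPolynomial (Fin 6) k)
    (hF₀ : Fs 0 = X 5 - X 1 ^ 2 - X 0 ^ 3) (hF₁ : Fs 1 = X 2 ^ 2 + X 5 ^ 3 + X 3 ^ 7 + X 4 ^ 8 + X 0 ^ 12)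
    (A : Finset (Fin 6 →₀ ℕ)) (hAJ : ∀ a ∈ A, ∃ j ∈ ({0, 5} : Finset (Fin 6)), 0 < a j)
    (hprim : ∀ j ∈ ({0, 5} : Finset (Fin 6)), ∃ N : ℕ, Finsupp.single j N ∈ A)
    (t : ℕ) (ht : 0 < t) (m : Fin t → (Fin 6 →₀ ℕ)) (hm : ∀ c : Fin t, m c ∈ A)
    (hcov : ∀ a ∈ A, ∃ (c : Fin t) (K : ℕ), 1 ≤ K ∧ ∃ y ∈ (Ideal.span ((fun b : Fin 6 →₀ ℕ =>
        (monomial b (1 : k) : MvPolynomial (Fin 6) k)) '' (A : Set (Fin 6 →₀ ℕ)))) ^ (K - 1),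
      (monomial a (1 : k) : MvPolynomial (Fin 6) k) ^ K = monomial (m c) 1 * y)
    (V : Fin t → Matrix (Fin 6) (Fin 6) ℕ) (hV : ∀ c, IsUnit ((V c).map (Nat.cast : ℕ → ℤ)).det)
    (a : Fin t → Fin 6 → (Fin 6 →₀ ℕ)) (haA : ∀ c i, a c i ∈ A)
    (hgen : ∀ (c : Fin t) (i : Fin 6), (Finsupp.equivFunOnFinite.symm ((V c).mulVec ⇑(a c i)) : Fin 6 →₀ ℕ) =
      Finsupp.equivFunOnFinite.symm ((V c).mulVec ⇑(m c)) + Finsupp.single i 1)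
    (hge : ∀ (c : Fin t), ∀ e ∈ A, (Finsupp.equivFunOnFinite.symm ((V c).mulVec ⇑(m c)) : Fin 6 →₀ ℕ) ≤
      Finsupp.equivFunOnFinite.symm ((V c).mulVec ⇑e))
    (gs : Fin t → Fin 2 → MvPolynomial (Fin 6) k) (d : Fin t → Fin 2 → (Fin 6 →₀ ℕ))
    (hθF : ∀ (c : Fin t) (l : Fin 2), aeval (fun j : Fin 6 => ∏ i : Fin 6, (X i : MvPolynomial (Fin 6) k) ^ V c i j) (Fs l) =
      monomial (d c l) (1 : k) * gs c l)
    (hunit : ∀ (c : Fin t) (l : Fin 2), ∃ (N : ℕ) (r' : Fin 6 →₀ ℕ), N • m c = ∑ j : Fin 6, d c l j • a c j + r')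
    (hcert : ∀ (c : Fin t) (S : Finset (Fin 6)), (∀ j ∈ ({0, 5} : Finset (Fin 6)), ∃ i ∈ S, 0 < V c i j) →
      ∃ (tt : ℕ) (js : Fin tt → Fin 2 → Fin 6) (e : Fin 6 →₀ ℕ), (∀ i ∈ S, e i = 0) ∧
      (monomial e (1 : k) : MvPolynomial (Fin 6) k) ∈
        Ideal.span (Set.range fun l : Fin 2 =>
            aeval (fun i : Fin 6 => if i ∈ S then (0 : MvPolynomial (Fin 6) k) else X i) (gs c l)) ⊔
          Ideal.span (Set.range fun μ : Fin tt => (Matrix.of fun i l => pderiv (js μ i)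
            (aeval (fun i : Fin 6 => if i ∈ S then (0 : MvPolynomial (Fin 6) k) else X i) (gs c l))).det)) :
    ∃ (X' : Scheme.{0}) (π : X' ⟶ Spec (.of (MvPolynomial (Fin 6) k ⧸ Ideal.span (Set.range Fs)))), IsProper π ∧
      Literature.AlgebraicGeometry.Resolution.IsBirational π ∧
      ∀ y : X', IsDomain (X'.presheaf.stalk y) ∧ ∀ dd : ℕ, ringKrullDim (X'.presheaf.stalk y) = dd →
        ∀ s : Fin dd → X'.presheaf.stalk y, (Ideal.span (Set.range s)).radical.IsMaximal →
          RingTheory.Sequence.IsWeaklyRegular (X'.presheaf.stalk y) (List.ofFn s) ∧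
          ∀ z : X'.presheaf.stalk y, (∃ e : ℕ, z ^ 7 ^ e ∈
              Ideal.span ((fun w : X'.presheaf.stalk y => w ^ 7 ^ e) ''
                (Ideal.span (Set.range s) : Set (X'.presheaf.stalk y)))) →
            z ∈ Ideal.span (Set.range s) := by
  haveI : Fact (Nat.Prime 7) := ⟨by norm_num⟩
  obtain ⟨hprime, hXne⟩ := T4PlusPrime.t4plus_prime_and_X_ne_zero k Fs hF₀ hF₁
  exact CIConeFiModelSmooth.ciConeFiModelRel_of_smoothFaceCertificates 7 k 6 ({0, 5} : Finset (Fin 6)) A hAJ hprim t ht m hm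
    hcov V hV a haA hgen hge Fs hprime hXne (T4PlusOffStratum.t4Plus_hoff_char7 k Fs hF₀ hF₁) gs d hθF hunit hcert

end Summit.ResolutionOfSingularities.ResolutionOfSingularities.Theorems.FInjectiveMacaulayfication.T4PlusFiModel

end
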